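import Mathlib.Algebra.MvPolynomial.Coeff
import Mathlib.Analysis.SpecialFunctions.Exponential
import Mathlib.Analysis.SpecialFunctions.Exp
import HarnessLib

/-!
# The multinomial law of i.i.d. marks and its Poisson randomization (Kingman 1993 §1.2, §2.5)

Two elementary identities behind the existence theorem for Poisson processes
(`Literature.Probability.Process.exists_isPoissonCloud`, J. F. C. Kingman, *Poisson Processes*
(1993), §2.5: a Poisson `𝒫(μ(S))` number of independent points of law `μ/μ(S)` is a Poisson
process with mean measure `μ`):

* `Literature.Probability.Process.sum_prod_eq_multinomial` — **the multinomial formula**: for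
  weights `w : σ → ℝ` on a finite set of categories `σ` and prescribed category counts
  `d : σ → ℕ`, the total weight `∑_f ∏_k w (f k)` of the maps `f : K → σ` from an `n`-element
  set whose fibres have the sizes `d` is `n!/(∏_j d_j!) ∏_j w_j^{d_j}` when `∑ d_j = n` and `0`
  otherwise (so that `n` i.i.d. trials with category probabilities `w` produce the count vector
  `d` with the multinomial probability); obtained by extracting a coefficient of
  `(∑_j w_j X_j)^n` (Mathlib's `MvPolynomial.coeff_linearCombination_X_pow_of_fintype`);
* `Literature.Probability.Process.hasSum_poisson_multinomial` — **Poisson randomization**: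
  mixing the multinomial probabilities of the counts `c : Fin q → ℕ` in `q` disjoint categories of
  probabilities `p_i` (the remaining category having probability `1 − ∑ p_i`) over a Poisson
  number `N ~ 𝒫(m)` of trials gives the product `∏_i e^{-m p_i} (m p_i)^{c_i}/c_i!` of Poisson
  probabilities (Kingman 1993 §1.2 "Bernoulli and Poisson", the computation behind the
  Existence Theorem of §2.5).
-/

noncomputable section

open Finset MvPolynomial
open scoped Nat

namespace Literature.Probability.Process

/-! ### Fibre counts of a map from a finite set -/

section Multinomial

variable {K σ : Type*} [Fintype K]

/-- The fibre-count vector of `f : K → σ` as a finitely supported function: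
`fiberCount f j = #{k | f k = j}`, written as `∑_k δ_{f k}`. [folklore] -/
def fiberCount (f : K → σ) : σ →₀ ℕ := ∑ k, Finsupp.single (f k) 1

/-- `fiberCount f j` is the number of `k` with `f k = j`. [folklore] -/
theorem fiberCount_apply [DecidableEq σ] (f : K → σ) (j : σ) :
    fiberCount f j = (univ.filter fun k ↦ f k = j).card := by
  rw [fiberCount, Finsupp.finsetSum_apply]
  simp only [Finsupp.single_apply]
  rw [Finset.card_filter]

/-- The total of the fibre counts is the size of the source. [folklore] -/
theorem sum_fiberCount [Fintype σ] [DecidableEq σ] (f : K → σ) :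
    ∑ j, fiberCount f j = Fintype.card K := by
  classical
  simp_rw [fiberCount_apply]
  rw [← Finset.card_univ, ← Finset.card_biUnion]
  · congr 1
    ext k
    simp
  · intro i _ j _ hij
    exact Finset.disjoint_filter.2 fun k _ hi hj ↦ hij (hi.symm.trans hj)

/-- The product `∏_k w_{f k} X_{f k}` is the monomial `X^{fiberCount f}` with coefficient
`∏_k w_{f k}`. [folklore] -/
theorem prod_smul_X_eq_monomial (w : σ → ℝ) (f : K → σ) :
    ∏ k, (w (f k) • X (f k) : MvPolynomial σ ℝ) = monomial (fiberCount f) (∏ k, w (f k)) := by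
  rw [fiberCount, monomial_sum_prod]
  refine Finset.prod_congr rfl fun k _ ↦ ?_
  rw [X, smul_monomial, smul_eq_mul, mul_one]

/-- **The multinomial formula.** For weights `w : σ → ℝ` and prescribed counts `d : σ → ℕ`,
`∑_{f : K → σ, fibres of sizes d} ∏_k w (f k) = [∑ d = |K|] · |K|!/(∏ d_j!) · ∏_j w_j^{d_j}`
(the coefficient of `∏ X_j^{d_j}` in `(∑_j w_j X_j)^{|K|} = ∏_k ∑_j w_j X_j`). With `w` the
category probabilities of a trial this is the multinomial law of the category counts of `|K|`
independent trials (Kingman 1993 §1.2). [folklore] -/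
theorem sum_prod_eq_multinomial [Fintype σ] [DecidableEq σ] [DecidableEq K] (w : σ → ℝ) (d : σ → ℕ) :
    (∑ f : K → σ with ∀ j, fiberCount f j = d j, ∏ k, w (f k)) =
      if ∑ j, d j = Fintype.card K then (Nat.multinomial univ d : ℝ) * ∏ j, w j ^ d j else 0 := by
  classical
  set s : σ →₀ ℕ := Finsupp.equivFunOnFinite.symm d with hs
  have hsd : ∀ j, s j = d j := fun j ↦ by simp [hs]
  -- the coefficient of `X^s` in `(∑ w_j X_j)^|K|`, computed in two ways
  have key := coeff_linearCombination_X_pow_of_fintype w s (Fintype.card K)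
  have hpow : ((∑ i, w i • X i : MvPolynomial σ ℝ)) ^ Fintype.card K =
      ∑ f : K → σ, monomial (fiberCount f) (∏ k, w (f k)) := by
    rw [← Finset.card_univ, ← Finset.prod_const, Finset.prod_univ_sum]
    simp only [Fintype.piFinset_univ]
    exact Finset.sum_congr rfl fun f _ ↦ prod_smul_X_eq_monomial w f
  rw [hpow, coeff_sum] at key
  simp only [coeff_monomial] at key
  rw [← Finset.sum_filter] at key
  -- left-hand sides agree
  have hfilter : (univ.filter fun f : K → σ ↦ fiberCount f = s) =
      univ.filter fun f : K → σ ↦ ∀ j, fiberCount f j = d j := by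
    refine Finset.filter_congr fun f _ ↦ ?_
    rw [Finsupp.ext_iff]
    exact forall_congr' fun j ↦ by rw [hsd]
  rw [hfilter] at key
  rw [key]
  -- right-hand sides agree
  have hsum : (s.sum fun _ m ↦ m) = ∑ j, d j := by
    rw [Finsupp.sum_fintype _ _ fun _ ↦ rfl]
    exact Finset.sum_congr rfl fun j _ ↦ hsd j
  have hmult : s.multinomial = Nat.multinomial univ d := by
    rw [Finsupp.multinomial_eq_of_support_subset (Finset.subset_univ _)]
    exact Nat.multinomial_congr fun j _ ↦ hsd j
  have hprod : (s.prod fun r m ↦ w r ^ m) = ∏ j, w j ^ d j := by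
    rw [Finsupp.prod_fintype _ _ fun _ ↦ pow_zero _]
    exact Finset.prod_congr rfl fun j _ ↦ by rw [hsd]
  rw [hsum, hmult, hprod]

end Multinomial

/-! ### Poisson randomization of the multinomial law -/

section Poisson

open Real

variable {q : ℕ}

/-- The category-count vector of `n` trials in `q + 1` categories (the `q` given ones, `some i`,
and the complementary one, `none`) compatible with prescribed counts `c : Fin q → ℕ` in the given
categories: `none ↦ n − ∑ c` (truncated), `some i ↦ c i`. Its total is `n` exactly when
`∑ c ≤ n`. [folklore] -/
def countVector (c : Fin q → ℕ) (n : ℕ) : Option (Fin q) → ℕ :=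
  fun j ↦ j.elim (n - ∑ i, c i) c

/-- `countVector c n none = n − ∑ c`. [folklore] -/
@[simp] theorem countVector_none (c : Fin q → ℕ) (n : ℕ) : countVector c n none = n - ∑ i, c i := rfl

/-- `countVector c n (some i) = c i`. [folklore] -/
@[simp] theorem countVector_some (c : Fin q → ℕ) (n : ℕ) (i : Fin q) : countVector c n (some i) = c i := rfl

/-- The weights of the `q + 1` categories: `p i` for `some i` and `1 − ∑ p` for `none`. [folklore] -/
def weightVector (p : Fin q → ℝ) : Option (Fin q) → ℝ :=
  fun j ↦ j.elim (1 - ∑ i, p i) p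

/-- `weightVector p none = 1 − ∑ p`. [folklore] -/
@[simp] theorem weightVector_none (p : Fin q → ℝ) : weightVector p none = 1 - ∑ i, p i := rfl

/-- `weightVector p (some i) = p i`. [folklore] -/
@[simp] theorem weightVector_some (p : Fin q → ℝ) (i : Fin q) : weightVector p (some i) = p i := rfl

/-- The multinomial probability that `n` independent trials with category probabilities
`weightVector p` give the counts `c` in the `q` given categories (and hence `n − ∑ c` in the
complementary one): `[∑ c ≤ n] · n!/((n − ∑ c)! ∏ c_i!) · (1 − ∑ p)^{n − ∑ c} ∏ p_i^{c_i}`, in the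
form produced by `sum_prod_eq_multinomial`. [folklore] -/
def multinomialProb (p : Fin q → ℝ) (c : Fin q → ℕ) (n : ℕ) : ℝ :=
  if ∑ j, countVector c n j = n then
    (Nat.multinomial univ (countVector c n) : ℝ) * ∏ j, weightVector p j ^ countVector c n j
  else 0

/-- The total count of `countVector c n` is `(n − ∑ c) + ∑ c`. [folklore] -/
theorem sum_countVector (c : Fin q → ℕ) (n : ℕ) :
    ∑ j, countVector c n j = (n - ∑ i, c i) + ∑ i, c i := by
  rw [Fintype.sum_option]
  rfl

/-- Below `∑ c` trials the multinomial probability of the counts `c` vanishes. [folklore] -/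
theorem multinomialProb_of_lt (p : Fin q → ℝ) (c : Fin q → ℕ) {n : ℕ} (hn : n < ∑ i, c i) :
    multinomialProb p c n = 0 := by
  rw [multinomialProb, if_neg]
  rw [sum_countVector]
  omega

/-- The multinomial coefficient of `countVector c (∑ c + r)`:
`(∑ c + r)! = r! ∏ c_i! · multinomial`. [folklore] -/
theorem multinomial_countVector_spec (c : Fin q → ℕ) (r : ℕ) :
    (r ! * ∏ i, (c i)!) * Nat.multinomial univ (countVector c (∑ i, c i + r)) = (∑ i, c i + r)! := by
  have h := Nat.multinomial_spec univ (countVector c (∑ i, c i + r))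
  rw [Fintype.prod_option, sum_countVector] at h
  simp only [countVector_none, countVector_some, add_tsub_cancel_left] at h
  rwa [add_comm r] at h

/-- The multinomial probability at `∑ c + r` trials, in closed form. [folklore] -/
theorem multinomialProb_add (p : Fin q → ℝ) (c : Fin q → ℕ) (r : ℕ) :
    multinomialProb p c (∑ i, c i + r) =
      ((∑ i, c i + r)! : ℝ) / ((r ! : ℝ) * ∏ i, ((c i)! : ℝ)) * ((1 - ∑ i, p i) ^ r * ∏ i, p i ^ c i) := by
  have hS : ∑ j, countVector c (∑ i, c i + r) j = ∑ i, c i + r := by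
    rw [sum_countVector, add_tsub_cancel_left, add_comm]
  rw [multinomialProb, if_pos hS]
  have hspec := multinomial_countVector_spec c r
  rw [mul_comm] at hspec
  have hne : ((r ! : ℝ) * ∏ i, ((c i)! : ℝ)) ≠ 0 := by positivity
  congr 1
  · rw [eq_div_iff hne]
    exact_mod_cast hspec
  · rw [Fintype.prod_option]
    simp

/-- **Poisson randomization of the multinomial law** (Kingman 1993 §1.2, §2.5): for category
probabilities `p_i ≥ 0` with `∑ p_i ≤ 1`, a rate `m ≥ 0` and counts `c : Fin q → ℕ`,
`∑_n e^{-m} m^n/n! · multinomialProb p c n = ∏_i e^{-m p_i} (m p_i)^{c_i} / c_i!` — a Poisson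
`𝒫(m)` number of independent trials produces independent Poisson `𝒫(m p_i)` counts in disjoint
categories. [cite: Kingman1993, §2.5 Existence Theorem] -/
theorem hasSum_poisson_multinomial (p : Fin q → ℝ) (c : Fin q → ℕ) (m : ℝ) :
    HasSum (fun n ↦ exp (-m) * m ^ n / n ! * multinomialProb p c n)
      (∏ i, exp (-(m * p i)) * (m * p i) ^ c i / (c i)!) := by
  set S := ∑ i, c i with hSdef
  set C : ℝ := exp (-m) * ∏ i, (m * p i) ^ c i / (c i)! with hC
  -- the shifted series is `C (m p₀)^r / r!`
  have hshift : ∀ r, exp (-m) * m ^ (r + S) / (r + S)! * multinomialProb p c (r + S) =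
      C * ((m * (1 - ∑ i, p i)) ^ r / r !) := by
    intro r
    rw [add_comm r S, hSdef, multinomialProb_add]
    have hf : ((∑ i, c i + r)! : ℝ) ≠ 0 := by positivity
    have hr : ((r ! : ℕ) : ℝ) ≠ 0 := by positivity
    have hc : (∏ i, ((c i)! : ℝ)) ≠ 0 := by
      rw [Finset.prod_ne_zero_iff]
      intro i _
      positivity
    rw [hC]
    simp_rw [mul_pow]
    rw [Finset.prod_div_distrib, Finset.prod_mul_distrib, Finset.prod_pow_eq_pow_sum, ← hSdef, pow_add]
    field_simp
  -- sum of the shifted series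
  have hexp : HasSum (fun r ↦ (m * (1 - ∑ i, p i)) ^ r / r !) (exp (m * (1 - ∑ i, p i))) := by
    have h := NormedSpace.expSeries_div_hasSum_exp (m * (1 - ∑ i, p i))
    rwa [← exp_eq_exp_ℝ] at h
  have htail : HasSum (fun r ↦ exp (-m) * m ^ (r + S) / (r + S)! * multinomialProb p c (r + S))
      (C * exp (m * (1 - ∑ i, p i))) := by
    simp_rw [hshift]
    exact hexp.mul_left C
  -- the first `S` terms vanish
  have hzero : ∑ i ∈ range S, exp (-m) * m ^ i / i ! * multinomialProb p c i = 0 := by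
    refine Finset.sum_eq_zero fun i hi ↦ ?_
    rw [multinomialProb_of_lt p c (by simpa [hSdef] using hi), mul_zero]
  have htarget : C * exp (m * (1 - ∑ i, p i)) = ∏ i, exp (-(m * p i)) * (m * p i) ^ c i / (c i)! := by
    rw [hC, mul_right_comm, ← exp_add, Finset.prod_div_distrib, Finset.prod_div_distrib,
      Finset.prod_mul_distrib, ← exp_sum, mul_div_assoc]
    congr 2
    rw [Finset.sum_neg_distrib, ← Finset.mul_sum]
    ring
  rw [← htarget]
  refine (hasSum_nat_add_iff' S).1 ?_
  rw [hzero, sub_zero]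
  exact htail

end Poisson

end Literature.Probability.Process

end
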